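import Summits.Ventures.PercRepro.GladkovThm62

/-!
# Gladkov's Theorem 1.1 / 6.2, inequality (13): `P(abc)² ≤ 8 · P(ab) · P(ac) · P(bc)`

Gladkov (arXiv:2408.08457, §6.2, proof of (13)): split the DFS from `a` stopped at `b` or `c`
(`MultiGraph.dfs`) by the target it finds — the stop events `R_b`, `R_c` (`stopEvent`), decided
by the tree (`DFSGood.lean`).  On `R_b` the witness pairs at the leaf lie in
`ac □_S bc ∪ bc □_S ac` (`disjOcc_of_leafState_stop`), so Theorem 5.2 (`DTree.cauchy_schwarz`
with `A = R_b`, `B = R_b ∩ abc`) and Theorem 4.3 (`DTree.vdbk`) give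
`P(R_b ∩ abc)² ≤ P(R_b) · 2 P(ac) P(bc) ≤ 2 P(ab) P(ac) P(bc)` (`R_b ⊆ ab`), and symmetrically
`P(R_c ∩ abc)² ≤ 2 P(ab) P(ac) P(bc)`.  Since `abc ⊆ R_b ∪ R_c` (the tree cannot exhaust the
cluster of `a` when `a ~ b`), `P(abc) ≤ P(R_b ∩ abc) + P(R_c ∩ abc)` and
`(x + y)² ≤ 2x² + 2y²` give (13): `gladkov_thm11_of_ne`, `gladkov_thm11`, and typer-2's
benchmark `Gladkov24Thm11_holds`.
-/

namespace PercRepro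

open Finset

namespace MultiGraph

variable {V E : Type*} {G : MultiGraph V E} [Fintype E] [DecidableEq E]

/-- **The stop bound**: for a target `u` with companion `u'` (`{u, u'} = {b, c}`, so that a stop
at `u` puts the pair in `au' □_S bc ∪ bc □_S au'`): `P(R_u ∩ abc)² ≤ P(R_u) · 2 P(au') P(bc)`.
Stated for the stop at `b` (companion `c`). -/
theorem stop_bound_b [DecidableEq V] {p : E → ℝ} (hp : IsProb p) {a b c : V}
    (hab : a ≠ b) (hac : a ≠ c) (hbc : b ≠ c) :
    prob p (G.stopEvent {b, c} Finset.univ a [] ∅ b ∩ (G.connEvent a b ∩ G.connEvent b c)) ^ 2 ≤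
      prob p (G.stopEvent {b, c} Finset.univ a [] ∅ b) *
        (2 * prob p (G.connEvent a c) * prob p (G.connEvent b c)) := by
  set T : Finset V := {b, c} with hT
  have haT : a ∉ T := by simp [hT, hab, hac]
  set t := G.dfs T Finset.univ a [] ∅ with ht
  have hgood := dfs_good_univ (G := G) T haT
  have hallS : DTree.AllS t := allS_dfs T _ _ _ _
  have hproper : DTree.Proper t ∅ := proper_dfs T _ _ _ _ ∅ fun e _ h => h
  set R := G.stopEvent T Finset.univ a [] ∅ b with hR
  set M := G.connEvent a b ∩ G.connEvent b c with hM
  set B := G.connEvent b c with hB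
  set C := G.connEvent a c with hC
  have hdec : DTree.Decides t ∅ (fun _ => false) R := hgood.2.1 b
  have hM_up : IsUpperSet M := (isUpperSet_connEvent G a b).inter (isUpperSet_connEvent G b c)
  have hB_up : IsUpperSet B := isUpperSet_connEvent G b c
  have hC_up : IsUpperSet C := isUpperSet_connEvent G a c
  -- Theorem 5.2 along the DFS tree with `A = R_b`
  have hcs := DTree.cauchy_schwarz hp hallS (DTree.continues_refl t) hproper hdec hM_up
  -- the pointwise inclusion at the leaves of `R_b`
  have hpt : ∀ ω ω' : Config E,
      (R ∩ M).indicator (1 : Config E → ℝ) ω * (R ∩ M).indicator 1 (mix (DTree.run t ω ω') ω ω') ≤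
        disjInd C B (DTree.run t ω ω') ω ω' + disjInd B C (DTree.run t ω ω') ω ω' := by
    intro ω ω'
    have h0 : ∀ (X Y : Set (Config E)) (S : Set E), 0 ≤ disjInd X Y S ω ω' := by
      intro X Y S
      unfold disjInd
      split_ifs <;> norm_num
    by_cases h1 : ω ∈ R ∩ M
    · by_cases h2 : mix (DTree.run t ω ω') ω ω' ∈ R ∩ M
      · rw [Set.indicator_of_mem h1, Set.indicator_of_mem h2]
        simp only [Pi.one_apply, mul_one]
        have hleaf := hgood.2.2 ω ω' fun e he => absurd he (Set.notMem_empty e)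
        rw [Set.empty_union] at hleaf
        have hstop : G.dfsStop T Finset.univ a [] ∅ ω = some b := h1.1
        rw [hstop] at hleaf
        rcases (disjOcc_of_leafState_stop hbc hleaf h1.2 h2.2).1 rfl with h | h
        · have : disjInd C B (DTree.run t ω ω') ω ω' = 1 := by unfold disjInd; rw [if_pos h]
          rw [this]; linarith [h0 B C (DTree.run t ω ω')]
        · have : disjInd B C (DTree.run t ω ω') ω ω' = 1 := by unfold disjInd; rw [if_pos h]
          rw [this]; linarith [h0 C B (DTree.run t ω ω')]
      · rw [Set.indicator_of_notMem h2, mul_zero]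
        exact add_nonneg (h0 _ _ _) (h0 _ _ _)
    · rw [Set.indicator_of_notMem h1, zero_mul]
      exact add_nonneg (h0 _ _ _) (h0 _ _ _)
  -- the two-copy sum: Theorem 4.3 twice
  have hsum : ∑ ω, ∑ ω', weight p ω * weight p ω' *
      ((R ∩ M).indicator 1 ω * (R ∩ M).indicator 1 (mix (DTree.run t ω ω') ω ω')) ≤
        prob p C * prob p B + prob p B * prob p C := by
    calc ∑ ω, ∑ ω', weight p ω * weight p ω' *
          ((R ∩ M).indicator 1 ω * (R ∩ M).indicator 1 (mix (DTree.run t ω ω') ω ω'))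
        ≤ ∑ ω, ∑ ω', weight p ω * weight p ω' *
            (disjInd C B (DTree.run t ω ω') ω ω' + disjInd B C (DTree.run t ω ω') ω ω') := by
          refine Finset.sum_le_sum fun ω _ => Finset.sum_le_sum fun ω' _ => ?_
          exact mul_le_mul_of_nonneg_left (hpt ω ω')
            (mul_nonneg (weight_nonneg hp ω) (weight_nonneg hp ω'))
      _ = (∑ ω, ∑ ω', weight p ω * weight p ω' * disjInd C B (DTree.run t ω ω') ω ω') +
            ∑ ω, ∑ ω', weight p ω * weight p ω' * disjInd B C (DTree.run t ω ω') ω ω' := by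
          simp only [mul_add, Finset.sum_add_distrib]
      _ ≤ prob p C * prob p B + prob p B * prob p C :=
          add_le_add (DTree.vdbk hp hproper hC_up hB_up) (DTree.vdbk hp hproper hB_up hC_up)
  calc prob p (R ∩ M) ^ 2
      ≤ prob p R * ∑ ω, ∑ ω', weight p ω * weight p ω' *
          ((R ∩ M).indicator 1 ω * (R ∩ M).indicator 1 (mix (DTree.run t ω ω') ω ω')) := hcs
    _ ≤ prob p R * (prob p C * prob p B + prob p B * prob p C) :=
        mul_le_mul_of_nonneg_left hsum (prob_nonneg hp R)
    _ = prob p R * (2 * prob p C * prob p B) := by ring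

/-- The stop bound for a stop at `c` (companion `b`): `P(R_c ∩ abc)² ≤ P(R_c) · 2 P(ab) P(bc)`. -/
theorem stop_bound_c [DecidableEq V] {p : E → ℝ} (hp : IsProb p) {a b c : V}
    (hab : a ≠ b) (hac : a ≠ c) (hbc : b ≠ c) :
    prob p (G.stopEvent {b, c} Finset.univ a [] ∅ c ∩ (G.connEvent a b ∩ G.connEvent b c)) ^ 2 ≤
      prob p (G.stopEvent {b, c} Finset.univ a [] ∅ c) *
        (2 * prob p (G.connEvent a b) * prob p (G.connEvent b c)) := by
  set T : Finset V := {b, c} with hT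
  have haT : a ∉ T := by simp [hT, hab, hac]
  set t := G.dfs T Finset.univ a [] ∅ with ht
  have hgood := dfs_good_univ (G := G) T haT
  have hallS : DTree.AllS t := allS_dfs T _ _ _ _
  have hproper : DTree.Proper t ∅ := proper_dfs T _ _ _ _ ∅ fun e _ h => h
  set R := G.stopEvent T Finset.univ a [] ∅ c with hR
  set M := G.connEvent a b ∩ G.connEvent b c with hM
  set B := G.connEvent b c with hB
  set D := G.connEvent a b with hD
  have hdec : DTree.Decides t ∅ (fun _ => false) R := hgood.2.1 c
  have hM_up : IsUpperSet M := (isUpperSet_connEvent G a b).inter (isUpperSet_connEvent G b c)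
  have hB_up : IsUpperSet B := isUpperSet_connEvent G b c
  have hD_up : IsUpperSet D := isUpperSet_connEvent G a b
  have hcs := DTree.cauchy_schwarz hp hallS (DTree.continues_refl t) hproper hdec hM_up
  have hpt : ∀ ω ω' : Config E,
      (R ∩ M).indicator (1 : Config E → ℝ) ω * (R ∩ M).indicator 1 (mix (DTree.run t ω ω') ω ω') ≤
        disjInd D B (DTree.run t ω ω') ω ω' + disjInd B D (DTree.run t ω ω') ω ω' := by
    intro ω ω'
    have h0 : ∀ (X Y : Set (Config E)) (S : Set E), 0 ≤ disjInd X Y S ω ω' := by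
      intro X Y S
      unfold disjInd
      split_ifs <;> norm_num
    by_cases h1 : ω ∈ R ∩ M
    · by_cases h2 : mix (DTree.run t ω ω') ω ω' ∈ R ∩ M
      · rw [Set.indicator_of_mem h1, Set.indicator_of_mem h2]
        simp only [Pi.one_apply, mul_one]
        have hleaf := hgood.2.2 ω ω' fun e he => absurd he (Set.notMem_empty e)
        rw [Set.empty_union] at hleaf
        have hstop : G.dfsStop T Finset.univ a [] ∅ ω = some c := h1.1
        rw [hstop] at hleaf
        rcases (disjOcc_of_leafState_stop hbc hleaf h1.2 h2.2).2 rfl with h | h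
        · have : disjInd D B (DTree.run t ω ω') ω ω' = 1 := by unfold disjInd; rw [if_pos h]
          rw [this]; linarith [h0 B D (DTree.run t ω ω')]
        · have : disjInd B D (DTree.run t ω ω') ω ω' = 1 := by unfold disjInd; rw [if_pos h]
          rw [this]; linarith [h0 D B (DTree.run t ω ω')]
      · rw [Set.indicator_of_notMem h2, mul_zero]
        exact add_nonneg (h0 _ _ _) (h0 _ _ _)
    · rw [Set.indicator_of_notMem h1, zero_mul]
      exact add_nonneg (h0 _ _ _) (h0 _ _ _)
  have hsum : ∑ ω, ∑ ω', weight p ω * weight p ω' *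
      ((R ∩ M).indicator 1 ω * (R ∩ M).indicator 1 (mix (DTree.run t ω ω') ω ω')) ≤
        prob p D * prob p B + prob p B * prob p D := by
    calc ∑ ω, ∑ ω', weight p ω * weight p ω' *
          ((R ∩ M).indicator 1 ω * (R ∩ M).indicator 1 (mix (DTree.run t ω ω') ω ω'))
        ≤ ∑ ω, ∑ ω', weight p ω * weight p ω' *
            (disjInd D B (DTree.run t ω ω') ω ω' + disjInd B D (DTree.run t ω ω') ω ω') := by
          refine Finset.sum_le_sum fun ω _ => Finset.sum_le_sum fun ω' _ => ?_
          exact mul_le_mul_of_nonneg_left (hpt ω ω')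
            (mul_nonneg (weight_nonneg hp ω) (weight_nonneg hp ω'))
      _ = (∑ ω, ∑ ω', weight p ω * weight p ω' * disjInd D B (DTree.run t ω ω') ω ω') +
            ∑ ω, ∑ ω', weight p ω * weight p ω' * disjInd B D (DTree.run t ω ω') ω ω' := by
          simp only [mul_add, Finset.sum_add_distrib]
      _ ≤ prob p D * prob p B + prob p B * prob p D :=
          add_le_add (DTree.vdbk hp hproper hD_up hB_up) (DTree.vdbk hp hproper hB_up hD_up)
  calc prob p (R ∩ M) ^ 2
      ≤ prob p R * ∑ ω, ∑ ω', weight p ω * weight p ω' *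
          ((R ∩ M).indicator 1 ω * (R ∩ M).indicator 1 (mix (DTree.run t ω ω') ω ω')) := hcs
    _ ≤ prob p R * (prob p D * prob p B + prob p B * prob p D) :=
        mul_le_mul_of_nonneg_left hsum (prob_nonneg hp R)
    _ = prob p R * (2 * prob p D * prob p B) := by ring

/-- A stop at `u` joins `a` to `u`: `R_u ⊆ au`. -/
theorem stopEvent_subset_connEvent [DecidableEq V] {a b c u : V} (hab : a ≠ b) (hac : a ≠ c) :
    G.stopEvent {b, c} Finset.univ a [] ∅ u ⊆ G.connEvent a u := by
  intro ω hω
  have hgood := dfs_good_univ (G := G) (a := a) {b, c} (by simp [hab, hac])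
  have hleaf := hgood.2.2 ω ω fun e he => absurd he (Set.notMem_empty e)
  have hstop : G.dfsStop {b, c} Finset.univ a [] ∅ ω = some u := hω
  rw [hstop] at hleaf
  rcases hleaf with ⟨top, L, Q, e, u', hr, -, -, hωe, hends, -, hpath, -⟩ | ⟨hr, -⟩
  · rw [Option.some_injective _ hr]
    refine hpath.conn.symm.trans (Conn.of_openAdj ⟨e, hωe, ?_⟩)
    rcases hends with ⟨h1, h2⟩ | ⟨h1, h2⟩
    · exact Or.inl ⟨h1, h2⟩
    · exact Or.inr ⟨h1, h2⟩
  · exact absurd hr (Option.some_ne_none u)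

/-- When `a ~ b` the DFS stops at `b` or at `c`: `abc ⊆ R_b ∪ R_c`. -/
theorem subset_stopEvent_union [DecidableEq V] {a b c : V} (hab : a ≠ b) (hac : a ≠ c) :
    G.connEvent a b ∩ G.connEvent b c ⊆
      G.stopEvent {b, c} Finset.univ a [] ∅ b ∪ G.stopEvent {b, c} Finset.univ a [] ∅ c := by
  intro ω hω
  have hgood := dfs_good_univ (G := G) (a := a) {b, c} (by simp [hab, hac])
  have hleaf := hgood.2.2 ω ω fun e he => absurd he (Set.notMem_empty e)
  obtain ⟨u, hu⟩ := Option.ne_none_iff_exists'.mp (leafState_ne_none hleaf hω.1)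
  have huT : u ∈ ({b, c} : Finset V) := by
    rw [hu] at hleaf
    rcases hleaf with ⟨_, _, _, _, u', hr, hu', -⟩ | ⟨hr, -⟩
    · rw [Option.some_injective _ hr]; exact hu'
    · exact absurd hr (Option.some_ne_none u)
  rcases Finset.mem_insert.mp huT with rfl | hu'
  · exact Or.inl hu
  · rw [Finset.mem_singleton.mp hu'] at hu
    exact Or.inr hu

/-- **Gladkov's inequality (13) for distinct marks**: `P(abc)² ≤ 8 · P(ab) · P(ac) · P(bc)`. -/
theorem gladkov_thm11_of_ne [DecidableEq V] {p : E → ℝ} (hp : IsProb p) {a b c : V}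
    (hab : a ≠ b) (hac : a ≠ c) (hbc : b ≠ c) :
    prob p (G.connEvent a b ∩ G.connEvent b c) ^ 2 ≤
      8 * prob p (G.connEvent a b) * prob p (G.connEvent a c) * prob p (G.connEvent b c) := by
  set M := G.connEvent a b ∩ G.connEvent b c with hM
  set Rb := G.stopEvent {b, c} Finset.univ a [] ∅ b with hRb
  set Rc := G.stopEvent {b, c} Finset.univ a [] ∅ c with hRc
  set x := prob p (Rb ∩ M) with hx
  set y := prob p (Rc ∩ M) with hy
  have hPab := prob_nonneg hp (G.connEvent a b)
  have hPac := prob_nonneg hp (G.connEvent a c)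
  have hPbc := prob_nonneg hp (G.connEvent b c)
  have hx0 : 0 ≤ x := prob_nonneg hp _
  have hy0 : 0 ≤ y := prob_nonneg hp _
  -- the two stop bounds, with `R_b ⊆ ab`, `R_c ⊆ ac`
  have hRb_le : prob p Rb ≤ prob p (G.connEvent a b) :=
    prob_mono hp (stopEvent_subset_connEvent hab hac)
  have hRc_le : prob p Rc ≤ prob p (G.connEvent a c) :=
    prob_mono hp (stopEvent_subset_connEvent hab hac)
  have hKb : x ^ 2 ≤ 2 * prob p (G.connEvent a b) * prob p (G.connEvent a c) *
      prob p (G.connEvent b c) := by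
    refine (stop_bound_b hp hab hac hbc).trans ?_
    have : 0 ≤ 2 * prob p (G.connEvent a c) * prob p (G.connEvent b c) := by positivity
    nlinarith [mul_le_mul_of_nonneg_right hRb_le this]
  have hKc : y ^ 2 ≤ 2 * prob p (G.connEvent a b) * prob p (G.connEvent a c) *
      prob p (G.connEvent b c) := by
    refine (stop_bound_c hp hab hac hbc).trans ?_
    have : 0 ≤ 2 * prob p (G.connEvent a b) * prob p (G.connEvent b c) := by positivity
    nlinarith [mul_le_mul_of_nonneg_right hRc_le this]
  -- `P(abc) ≤ x + y`
  have hsplit : prob p M ≤ x + y := by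
    have hsub : M ⊆ (Rb ∩ M) ∪ (Rc ∩ M) := by
      intro ω hω
      rcases subset_stopEvent_union hab hac hω with h | h
      · exact Or.inl ⟨h, hω⟩
      · exact Or.inr ⟨h, hω⟩
    exact (prob_mono hp hsub).trans (prob_union_le hp _ _)
  have hM0 : 0 ≤ prob p M := prob_nonneg hp M
  -- `(x + y)² ≤ 2x² + 2y²`
  calc prob p M ^ 2 ≤ (x + y) ^ 2 := by gcongr
    _ ≤ 2 * x ^ 2 + 2 * y ^ 2 := by nlinarith [sq_nonneg (x - y)]
    _ ≤ 8 * prob p (G.connEvent a b) * prob p (G.connEvent a c) * prob p (G.connEvent b c) := by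
        nlinarith [hKb, hKc]

/-- **Gladkov's Theorem 1.1 / (13)**: `P(abc)² ≤ 8 · P(ab) · P(ac) · P(bc)` for every three
vertices. -/
theorem gladkov_thm11 {p : E → ℝ} (hp : IsProb p) (a b c : V) :
    prob p (G.connEvent a b ∩ G.connEvent b c) ^ 2 ≤
      8 * prob p (G.connEvent a b) * prob p (G.connEvent a c) * prob p (G.connEvent b c) := by
  classical
  have h0 : ∀ X : Set (Config E), 0 ≤ prob p X := prob_nonneg hp
  have h1 : ∀ X : Set (Config E), prob p X ≤ 1 := prob_le_one hp
  by_cases hab : a = b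
  · subst hab
    rw [connEvent_self, Set.univ_inter, prob_univ]
    nlinarith [h0 (G.connEvent a c), h1 (G.connEvent a c)]
  by_cases hac : a = c
  · subst hac
    rw [connEvent_self, prob_univ, connEvent_comm G b a, Set.inter_self]
    nlinarith [h0 (G.connEvent a b), h1 (G.connEvent a b)]
  by_cases hbc : b = c
  · subst hbc
    rw [connEvent_self, Set.inter_univ, prob_univ]
    nlinarith [h0 (G.connEvent a b), h1 (G.connEvent a b)]
  exact gladkov_thm11_of_ne hp hab hac hbc

end MultiGraph

/-- **`Gladkov24Thm11` is a theorem**: typer-2's benchmark statement of Gladkov's (13). -/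
theorem Gladkov24Thm11_holds : Gladkov24Thm11 :=
  fun G _ hp a b c => G.gladkov_thm11 hp a b c

end PercRepro
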